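import Literature.Geometry.Lorentzian.KerrDataSchwarzschildExtrinsic
import Literature.Geometry.Lorentzian.LandauLifshitzPseudotensor
import Mathlib.LinearAlgebra.Matrix.SchurComplement

/-!
# Route EIHFluxBalance — crux `InertialRecession`: the Landau–Lifshitz value objects of the
# Schwarzschild metric in Kerr–Schild coordinates

Helper file (`--supports stmt-FinalStateConjecture-10166`) for the crux
`Summit.FinalStateConjecture.FinalStateConjecture.Theses.EIHFluxBalance.InertialRecession`: first
half of the **exact Landau–Lifshitz charge of a Schwarzschild hole at rest** (`a = 0`, `Λ = 1` of
the missing lemma `S3bMissing.KerrSchildExactCharge` of line `old-light-leaves-the-cone`, which is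
also the normalisation check of `LandauLifshitz.quasiLocalMomentum` every charge-identification
stub of both lines relies on). For the Schwarzschild components in Kerr–Schild (ingoing
Eddington–Finkelstein Cartesian) form `g = η + (2M/r) ℓ ⊗ ℓ`, `ℓ = (1, x̄/r)`, `r = |x̄|`
(`Kerr.bilinZero M`, equal to `Kerr.bilin M 0` off the axis), we compute the derivative-free
Landau–Lifshitz objects of `LandauLifshitzPseudotensor.lean` in closed form:
* `gram_bilinZero` — `(g_{μν}) = η + (2M/r) k kᵀ`, `k = (1, x̄/r)`;
* `upper_bilinZero` — `(g^{μν}) = η − (2M/r) k♯ k♯ᵀ`, `k♯ = (−1, x̄/r)` (`ℓ` is null);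
* `metricDet_bilinZero` — `det (g_{μν}) = −1` (matrix determinant lemma);
* `superpotential_bilinZero_…` — the components `H^{0β0j}`, `H^{kβ0j}` entering the momentum
  densities `h^{μ0j}`: the rank-one terms cancel and `H` is AFFINE in `(2M/r) k♯ k♯ᵀ`:
  `H^{0,l,0,j} = −δ_{lj}(1 + 2M/r) + 2M x_l x_j / r³`, `H^{0,0,0,j} = 0`,
  `H^{k,l,0,j} = 2M (x_k δ_{lj} − x_l δ_{kj}) / r²`, and every value object depends on `x̄` only.
Kerr–Schild 1965, §2 (`det g = det η`, `g⁻¹ = η − 2H ℓ♯ ⊗ ℓ♯`); Landau–Lifshitz §96 (96.2)–(96.3);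
Virbhadra, Phys. Rev. D 41 (1990) 1086 (energy of Kerr–Newman in Kerr–Schild Cartesian
coordinates: `E = M` for `Q = 0`). [cite: KerrSchild1965, §2] [cite: LandauLifshitz1975, §96]
-/

set_option linter.dupNamespace false
-- instance search on the nested operator spaces `E4 →L[ℝ] E4 →L[ℝ] ℝ` is deep
set_option maxSynthPendingDepth 3

noncomputable section

open Set Filter Matrix
open scoped Topology Matrix RealInnerProductSpace

namespace Summit.FinalStateConjecture.FinalStateConjecture.Theorems

namespace LLSchwarzschild

open Literature.Geometry.Lorentzian Literature.Geometry.Lorentzian.LandauLifshitz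
open Literature.Geometry.Lorentzian.Kerr

/-! ### Components of the Kerr–Schild covector on the coordinate basis -/

/-- The spatial part of a spatial basis vector of `E4` is the corresponding basis vector of `E3`.
[folklore] -/
theorem spatial_basisVector_succ (i : Fin 3) :
    E4.spatial (E4.basisVector i.succ) = EuclideanSpace.single i 1 := by
  ext j
  rw [E4.spatial_apply]
  by_cases h : j = i
  · subst h; simp [E4.basisVector]
  · simp [E4.basisVector, h, (Fin.succ_injective 3).ne h]

/-- `ℓ(∂₀) = 1` for the Kerr–Schild covector at `a = 0`. [cite: arXiv07060622, (34)] -/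
theorem nullCovectorZero_basisVector_zero (x : E4) : nullCovectorZero x (E4.basisVector 0) = 1 := by
  rw [nullCovectorZero_apply, spatial_basisVector_zero, inner_zero_right, mul_zero, add_zero]
  simp [E4.basisVector]

/-- `ℓ(∂_{i+1}) = x_{i+1} / |x̄|` for the Kerr–Schild covector at `a = 0`. [cite: arXiv07060622, (34)] -/
theorem nullCovectorZero_basisVector_succ (x : E4) (i : Fin 3) :
    nullCovectorZero x (E4.basisVector i.succ) = x i.succ / ‖E4.spatial x‖ := by
  rw [nullCovectorZero_apply, spatial_basisVector_succ, EuclideanSpace.inner_single_right]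
  simp [E4.basisVector, Fin.succ_ne_zero, E4.spatial_apply, div_eq_inv_mul]

/-- `η(∂_μ, ∂_ν)` on the coordinate basis: `diag(−1, 1, 1, 1)`. [cite: ONeill1983, Ch. 3 p. 55] -/
theorem minkowski_basisVector (μ ν : Fin 4) :
    Minkowski.bilin (E4.basisVector μ) (E4.basisVector ν) =
      Matrix.diagonal ![(-1 : ℝ), 1, 1, 1] μ ν := by
  rw [Minkowski.bilin_apply]
  fin_cases μ <;> fin_cases ν <;> simp [E4.basisVector, Fin.sum_univ_three, PiLp.single_apply]

/-! ### The matrix of components and its inverse -/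

variable (M : ℝ)

/-- **The components of the Schwarzschild Kerr–Schild metric**: `(g_{μν})(x) = η + (2M/r) k kᵀ`
with `k = (1, x₁/r, x₂/r, x₃/r)`, `r = |x̄|`. [cite: KerrSchild1965, §2] -/
theorem gram_bilinZero (x : E4) :
    gram (bilinZero M) x = Matrix.diagonal ![(-1 : ℝ), 1, 1, 1] +
      (2 * M / ‖E4.spatial x‖) • vecMulVec
        ![1, x 1 / ‖E4.spatial x‖, x 2 / ‖E4.spatial x‖, x 3 / ‖E4.spatial x‖]
        ![1, x 1 / ‖E4.spatial x‖, x 2 / ‖E4.spatial x‖, x 3 / ‖E4.spatial x‖] := by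
  ext μ ν
  rw [gram_apply, bilinZero_apply, minkowski_basisVector, Matrix.add_apply, Matrix.smul_apply,
    vecMulVec_apply, smul_eq_mul]
  congr 1
  have hk : ∀ α : Fin 4, nullCovectorZero x (E4.basisVector α) =
      ![1, x 1 / ‖E4.spatial x‖, x 2 / ‖E4.spatial x‖, x 3 / ‖E4.spatial x‖] α := by
    intro α
    refine Fin.cases ?_ (fun i ↦ ?_) α
    · rw [nullCovectorZero_basisVector_zero]; rfl
    · rw [nullCovectorZero_basisVector_succ]
      fin_cases i <;> rfl
  rw [hk μ, hk ν]

/-- `x₁² + x₂² + x₃² = |x̄|²`. [folklore] -/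
theorem sum_sq_eq_norm_sq (x : E4) : x 1 ^ 2 + x 2 ^ 2 + x 3 ^ 2 = ‖E4.spatial x‖ ^ 2 := by
  rw [← E4.spatialNorm_sq]; rfl

/-- `η² = 1` for the coordinate matrix of `η`. [folklore] -/
theorem eta_mul_eta :
    Matrix.diagonal ![(-1 : ℝ), 1, 1, 1] * Matrix.diagonal ![(-1 : ℝ), 1, 1, 1] = 1 := by
  rw [diagonal_mul_diagonal, ← diagonal_one]
  congr 1
  funext i
  fin_cases i <;> simp

/-- `det η = −1`. [folklore] -/
theorem det_eta : (Matrix.diagonal ![(-1 : ℝ), 1, 1, 1]).det = -1 := by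
  rw [det_diagonal, Fin.prod_univ_four]
  simp

/-- The null identity `k ⬝ k♯ = −1 + |x̄|²/r² = 0` off the axis. [cite: KerrSchild1965, §2] -/
theorem kLow_dot_kUp {x : E4} (hx : E4.spatial x ≠ 0) :
    ![1, x 1 / ‖E4.spatial x‖, x 2 / ‖E4.spatial x‖, x 3 / ‖E4.spatial x‖] ⬝ᵥ
      ![-1, x 1 / ‖E4.spatial x‖, x 2 / ‖E4.spatial x‖, x 3 / ‖E4.spatial x‖] = 0 := by
  have hr : ‖E4.spatial x‖ ≠ 0 := norm_ne_zero_iff.2 hx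
  have hs := sum_sq_eq_norm_sq x
  simp only [dotProduct, Fin.sum_univ_four, Matrix.cons_val_zero, Matrix.cons_val_one,
    Matrix.cons_val]
  field_simp
  linear_combination hs

/-- `η k♯ = k`. [folklore] -/
theorem eta_mulVec_kUp (x : E4) :
    Matrix.diagonal ![(-1 : ℝ), 1, 1, 1] *ᵥ
        ![-1, x 1 / ‖E4.spatial x‖, x 2 / ‖E4.spatial x‖, x 3 / ‖E4.spatial x‖] =
      ![1, x 1 / ‖E4.spatial x‖, x 2 / ‖E4.spatial x‖, x 3 / ‖E4.spatial x‖] := by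
  funext i
  rw [mulVec_diagonal]
  fin_cases i <;> simp

/-- `kᵀ η = k♯ᵀ`. [folklore] -/
theorem kLow_vecMul_eta (x : E4) :
    ![1, x 1 / ‖E4.spatial x‖, x 2 / ‖E4.spatial x‖, x 3 / ‖E4.spatial x‖] ᵥ*
        Matrix.diagonal ![(-1 : ℝ), 1, 1, 1] =
      ![-1, x 1 / ‖E4.spatial x‖, x 2 / ‖E4.spatial x‖, x 3 / ‖E4.spatial x‖] := by
  funext i
  rw [vecMul_diagonal]
  fin_cases i <;> simp

/-- **The inverse components of the Schwarzschild Kerr–Schild metric** off the axis: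
`(g^{μν})(x) = η − (2M/r) k♯ k♯ᵀ`, `k♯ = (−1, x₁/r, x₂/r, x₃/r)` — because `ℓ` is `η`-null,
`(η + f k kᵀ)(η − f k♯ k♯ᵀ) = 1`. Kerr–Schild 1965, §2. [cite: KerrSchild1965, §2] -/
theorem upper_bilinZero {x : E4} (hx : E4.spatial x ≠ 0) :
    upper (bilinZero M) x = Matrix.diagonal ![(-1 : ℝ), 1, 1, 1] -
      (2 * M / ‖E4.spatial x‖) • vecMulVec
        ![-1, x 1 / ‖E4.spatial x‖, x 2 / ‖E4.spatial x‖, x 3 / ‖E4.spatial x‖]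
        ![-1, x 1 / ‖E4.spatial x‖, x 2 / ‖E4.spatial x‖, x 3 / ‖E4.spatial x‖] := by
  rw [upper, gram_bilinZero]
  apply inv_eq_right_inv
  rw [add_mul, mul_sub, mul_sub, eta_mul_eta, Matrix.mul_smul, mul_vecMulVec, eta_mulVec_kUp,
    Matrix.smul_mul, vecMulVec_mul, kLow_vecMul_eta, Matrix.smul_mul, Matrix.mul_smul,
    vecMulVec_mul_vecMulVec, kLow_dot_kUp hx, zero_smul, vecMulVec_zero, smul_zero, smul_zero,
    sub_zero]
  abel

/-- **`det (g_{μν}) = −1` for the Schwarzschild Kerr–Schild metric** off the axis (matrix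
determinant lemma: `det(η + f k kᵀ) = det η · (1 + f kᵀ η⁻¹ k) = det η`, `ℓ` null).
Kerr–Schild 1965, §2. [cite: KerrSchild1965, §2] -/
theorem metricDet_bilinZero {x : E4} (hx : E4.spatial x ≠ 0) : metricDet (bilinZero M) x = -1 := by
  rw [metricDet, gram_bilinZero]
  set r : ℝ := ‖E4.spatial x‖ with hr
  set k : Fin 4 → ℝ := ![1, x 1 / r, x 2 / r, x 3 / r] with hk
  set D : Matrix (Fin 4) (Fin 4) ℝ := Matrix.diagonal ![(-1 : ℝ), 1, 1, 1] with hD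
  have hDu : IsUnit D.det := by
    rw [hD, det_eta]
    exact isUnit_iff_ne_zero.2 (by norm_num)
  have hDinv : D⁻¹ = D := inv_eq_right_inv eta_mul_eta
  have hvec : (2 * M / r) • vecMulVec k k =
      replicateCol Unit ((2 * M / r) • k) * replicateRow Unit k := by
    rw [← vecMulVec_eq, smul_vecMulVec]
  rw [hvec, det_add_replicateCol_mul_replicateRow hDu, hD, det_eta, det_unique, hDinv,
    ← replicateRow_vecMul, kLow_vecMul_eta, Matrix.add_apply, Matrix.one_apply_eq,
    replicateRow_mul_replicateCol_apply, dotProduct_smul, dotProduct_comm, kLow_dot_kUp hx,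
    smul_zero, add_zero, mul_one]

/-! ### The superpotential components entering the momentum densities -/

/-- Entries of `η − f k♯ k♯ᵀ`. [folklore] -/
theorem upper_bilinZero_apply {x : E4} (hx : E4.spatial x ≠ 0) (μ ν : Fin 4) :
    upper (bilinZero M) x μ ν = Matrix.diagonal ![(-1 : ℝ), 1, 1, 1] μ ν -
      2 * M / ‖E4.spatial x‖ *
        (![-1, x 1 / ‖E4.spatial x‖, x 2 / ‖E4.spatial x‖, x 3 / ‖E4.spatial x‖] μ *
          ![-1, x 1 / ‖E4.spatial x‖, x 2 / ‖E4.spatial x‖, x 3 / ‖E4.spatial x‖] ν) := by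
  rw [upper_bilinZero M hx, Matrix.sub_apply, Matrix.smul_apply, vecMulVec_apply, smul_eq_mul]

/-- `g^{00} = −1 − 2M/r`. [cite: KerrSchild1965, §2] -/
theorem upper_bilinZero_zero_zero {x : E4} (hx : E4.spatial x ≠ 0) :
    upper (bilinZero M) x 0 0 = -1 - 2 * M / ‖E4.spatial x‖ := by
  rw [upper_bilinZero_apply M hx]
  simp

/-- `g^{0,j+1} = 2M x_{j+1} / r²`. [cite: KerrSchild1965, §2] -/
theorem upper_bilinZero_zero_succ {x : E4} (hx : E4.spatial x ≠ 0) (j : Fin 3) :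
    upper (bilinZero M) x 0 j.succ = 2 * M * x j.succ / ‖E4.spatial x‖ ^ 2 := by
  rw [upper_bilinZero_apply M hx]
  fin_cases j <;> simp <;> ring

/-- `g^{j+1,0} = 2M x_{j+1} / r²`. [cite: KerrSchild1965, §2] -/
theorem upper_bilinZero_succ_zero {x : E4} (hx : E4.spatial x ≠ 0) (j : Fin 3) :
    upper (bilinZero M) x j.succ 0 = 2 * M * x j.succ / ‖E4.spatial x‖ ^ 2 := by
  rw [upper_bilinZero_apply M hx]
  fin_cases j <;> simp <;> ring

/-- `g^{i+1,j+1} = δ_{ij} − 2M x_{i+1} x_{j+1} / r³`. [cite: KerrSchild1965, §2] -/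
theorem upper_bilinZero_succ_succ {x : E4} (hx : E4.spatial x ≠ 0) (i j : Fin 3) :
    upper (bilinZero M) x i.succ j.succ =
      (if i = j then 1 else 0) - 2 * M * x i.succ * x j.succ / ‖E4.spatial x‖ ^ 3 := by
  rw [upper_bilinZero_apply M hx]
  fin_cases i <;> fin_cases j <;> simp <;> ring

/-- **`H^{0,0,0,j+1} = 0`** for the Schwarzschild Kerr–Schild metric (indeed for any metric:
`H^{μανβ}` is antisymmetric in `(μ, α)`). [cite: LandauLifshitz1975, §96 (96.3)] -/
theorem superpotential_bilinZero_zero_zero_zero_succ (x : E4) (j : Fin 3) :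
    superpotential (bilinZero M) x 0 0 0 j.succ = 0 := by
  rw [superpotential]
  ring

/-- **`H^{0,l+1,0,j+1} = −δ_{lj}(1 + 2M/r) + 2M x_{l+1} x_{j+1} / r³`** off the axis: the
rank-one (quadratic in `M`) terms cancel. [cite: LandauLifshitz1975, §96 (96.3)] -/
theorem superpotential_bilinZero_zero_succ_zero_succ {x : E4} (hx : E4.spatial x ≠ 0) (l j : Fin 3) :
    superpotential (bilinZero M) x 0 l.succ 0 j.succ =
      -(if l = j then 1 else 0) * (1 + 2 * M / ‖E4.spatial x‖) +
        2 * M * x l.succ * x j.succ / ‖E4.spatial x‖ ^ 3 := by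
  have hr : ‖E4.spatial x‖ ≠ 0 := norm_ne_zero_iff.2 hx
  rw [superpotential, metricDet_bilinZero M hx, upper_bilinZero_zero_zero M hx,
    upper_bilinZero_succ_succ M hx, upper_bilinZero_succ_zero M hx, upper_bilinZero_zero_succ M hx]
  field_simp
  ring

/-- **`H^{k+1,l+1,0,j+1} = 2M (x_{k+1} δ_{lj} − x_{l+1} δ_{kj}) / r²`** off the axis.
[cite: LandauLifshitz1975, §96 (96.3)] -/
theorem superpotential_bilinZero_succ_succ_zero_succ {x : E4} (hx : E4.spatial x ≠ 0)
    (k l j : Fin 3) :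
    superpotential (bilinZero M) x k.succ l.succ 0 j.succ =
      2 * M * (x k.succ * (if l = j then 1 else 0) - x l.succ * (if k = j then 1 else 0)) /
        ‖E4.spatial x‖ ^ 2 := by
  have hr : ‖E4.spatial x‖ ≠ 0 := norm_ne_zero_iff.2 hx
  rw [superpotential, metricDet_bilinZero M hx, upper_bilinZero_succ_zero M hx,
    upper_bilinZero_succ_succ M hx, upper_bilinZero_succ_zero M hx, upper_bilinZero_succ_succ M hx]
  field_simp
  ring

/-! ### Dependence on the spatial part only -/

/-- The Schwarzschild Kerr–Schild components depend on `x̄` only. [cite: arXiv07060622, (32)–(34)] -/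
theorem bilinZero_eq_of_spatial_eq {x y : E4} (h : E4.spatial x = E4.spatial y) :
    bilinZero M x = bilinZero M y := by
  ext A B
  simp only [bilinZero_apply, nullCovectorZero_apply, h]

/-- Hence so does every derivative-free Landau–Lifshitz object, e.g. the superpotential.
[cite: LandauLifshitz1975, §96 (96.3)] -/
theorem superpotential_bilinZero_eq_of_spatial_eq {x y : E4} (h : E4.spatial x = E4.spatial y)
    (μ α ν β : Fin 4) :
    superpotential (bilinZero M) x μ α ν β = superpotential (bilinZero M) y μ α ν β := by
  simp only [superpotential, upper, metricDet, LandauLifshitz.gram, bilinZero_eq_of_spatial_eq M h]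


/-- **`det (g_{μν}) = −1` for Schwarzschild in Kerr–Schild form**, registered form (sub-goal
`schwarzschild_metricDet` of the crux item). Kerr–Schild 1965, §2. [cite: KerrSchild1965, §2] -/
theorem schwarzschild_metricDet : open Literature.Geometry.Lorentzian in ∀ (M : ℝ) (x : E4), E4.spatial x ≠ 0 → LandauLifshitz.metricDet (Kerr.bilinZero M) x = -1 :=
  fun M _x hx ↦ metricDet_bilinZero M hx

end LLSchwarzschild

end Summit.FinalStateConjecture.FinalStateConjecture.Theorems

end
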